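import Mathlib
import Summits.Ventures.PercRepro2.TB14FoldLeaf

/-!
# The pendant rule for typed BHK 1.4 (single-vertex): a leaf `o` at `v` reduces to the mark `v`
(blind cell PercRepro2, mine-c g13, 2026-08-25; MINE-C.md §22; the pendant map of row 2′TB)

If `o` has a single edge `e₁ = {v, o}` and `e₁` is free, then the folded (TB14) count for the
mark `o` at the profile `(F, z)` equals the folded count for the mark `v` at the profile
`(F ∖ {e₁}, z[e₁ ↦ closed])`: pairing a first copy with the same copy with `e₁` toggled, the two
terms add up to the `v`-term of the configuration with `e₁` closed (`pairCount_fold_pendant`).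
Hence (TB14) for `(b, o)` on the graph is (TB14) for `(b, v)` on the graph with the leaf deleted
(`tb14_slack_pendant`). When `e₁` is pinned open the two folded counts agree pointwise; pinned
closed, the `o`-count vanishes (`pairCount_fold_pendant_open`, `pairCount_fold_pendant_closed`).
Axioms: standard.
-/

namespace Summit.Ventures.PercRepro2

namespace TB14Fold

open CovForm A3InactiveTyped

section Pendant

variable {V : Type} {E : Type} [Fintype E] [DecidableEq E]

omit [Fintype E] [DecidableEq E] in
/-- The leaf `o` is joined to `a₂` iff the leaf edge is open and `v` is joined to `a₂`. -/
lemma conn_leaf_at_iff {ends : E → Sym2 V} {v o a₂ : V} {e₁ : E} (h₁ : ends e₁ = s(v, o))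
    (hleaf : ∀ e, o ∈ ends e → e = e₁) (ho : o ≠ a₂) (y : Config E) :
    Conn ends y a₂ o ↔ (y e₁ = true ∧ Conn ends y a₂ v) := by
  constructor
  · intro h
    have hopen : y e₁ = true := by
      by_contra hcl
      have hS : o ∈ ({z | z ≠ o} : Set V) := by
        refine mem_of_conn_of_closed (S := {z | z ≠ o}) ?_ (show a₂ ≠ o from ho.symm) h
        intro x hx w hxw hwo
        obtain ⟨_, e, he, hends⟩ := openGraph_adj.1 hxw
        subst hwo
        have he1 : e = e₁ := hleaf e (by rw [hends]; exact Sym2.mem_mk_right x w)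
        subst he1
        exact hcl he
      exact hS rfl
    refine ⟨hopen, conn_trans h (conn_of_openAdj ⟨e₁, hopen, by rw [h₁, Sym2.eq_swap]⟩)⟩
  · rintro ⟨hopen, h⟩
    exact conn_trans h (conn_of_openAdj ⟨e₁, hopen, h₁⟩)

omit [Fintype E] in
/-- Closing the leaf edge. -/
noncomputable def closeLeaf (e₁ : E) (y : Config E) : Config E := Function.update y e₁ false

omit [Fintype E] in
/-- `closeLeaf` agrees with `y` off `e₁`. -/
lemma closeLeaf_of_ne {e₁ e : E} (h : e ≠ e₁) (y : Config E) : closeLeaf e₁ y e = y e := by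
  simp [closeLeaf, Function.update_of_ne h]

omit [Fintype E] in
/-- `closeLeaf` closes `e₁`. -/
lemma closeLeaf_self (e₁ : E) (y : Config E) : closeLeaf e₁ y e₁ = false := by
  simp [closeLeaf]

omit [Fintype E] [DecidableEq E] in
/-- Connections between vertices other than the leaf do not see the leaf edge (both directions). -/
lemma conn_leaf_agree_iff {ends : E → Sym2 V} {v o : V} {e₁ : E} (h₁ : ends e₁ = s(v, o))
    (hleaf : ∀ e, o ∈ ends e → e = e₁) {y y' : Config E}
    (hagree : ∀ e, e ≠ e₁ → y' e = y e) {u u' : V} (hu : u ≠ o) (hu' : u' ≠ o) :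
    Conn ends y' u u' ↔ Conn ends y u u' :=
  ⟨conn_of_leaf_agree h₁ hleaf (y := y') (y' := y) (fun e he => (hagree e he).symm) hu hu',
    conn_of_leaf_agree h₁ hleaf hagree hu hu'⟩

variable {R : Type*} [Field R]

omit [Fintype E] [DecidableEq E] in
open Classical in
/-- `1_{o ∈ C₂}` and `1_{v ∈ C₂'}` agree when the two connection events are equivalent. -/
lemma iH_congr' {ends : E → Sym2 V} {a₂ o a₂' v : V} {ω ω' : Config E}
    (h : Conn ends ω a₂ o ↔ Conn ends ω' a₂' v) : (iH ends a₂ o ω : R) = iH ends a₂' v ω' := by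
  rw [iH_eq_ite, iH_eq_ite]
  by_cases hc : Conn ends ω a₂ o
  · rw [if_pos (show o ∈ cluster ends ω a₂ from hc), if_pos (show v ∈ cluster ends ω' a₂' from h.1 hc)]
  · rw [if_neg (show o ∉ cluster ends ω a₂ from hc),
      if_neg (show v ∉ cluster ends ω' a₂' from fun hc' => hc (h.2 hc'))]

omit [Fintype E] in
/-- The second copy of the closed-leaf configuration at the smaller profile is the closed-leaf
configuration of the second copy. -/
lemma flip_erase_closeLeaf (F : Finset E) (e₁ : E) (y : Config E) :
    A3InactiveTyped.flipOn (F.erase e₁) (closeLeaf e₁ y) = closeLeaf e₁ (A3InactiveTyped.flipOn F y) := by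
  funext e
  by_cases he : e = e₁
  · subst he; simp [A3InactiveTyped.flipOn, closeLeaf]
  · simp [A3InactiveTyped.flipOn, closeLeaf, he]

omit [Fintype E] in
/-- The folded `o`-term of a first copy with the leaf edge open and of the same copy with the leaf
edge closed add up to the folded `v`-term at the closed-leaf configuration. -/
lemma fold_leaf_pair (ends : E → Sym2 V) (a₁ a₂ b v o : V) (F : Finset E) (e₁ : E)
    (h₁ : ends e₁ = s(v, o)) (hleaf : ∀ e, o ∈ ends e → e = e₁) (ho2 : o ≠ a₂) (ho1 : o ≠ a₁)
    (hob : o ≠ b) (hov : o ≠ v) (hF : e₁ ∈ F) (y : Config E) (hy : y e₁ = true) :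
    (foldBO ends a₁ a₂ b o y (A3InactiveTyped.flipOn F y) : R) +
      foldBO ends a₁ a₂ b o (closeLeaf e₁ y) (A3InactiveTyped.flipOn F (closeLeaf e₁ y)) =
      foldBO ends a₁ a₂ b v (closeLeaf e₁ y) (A3InactiveTyped.flipOn (F.erase e₁) (closeLeaf e₁ y)) := by
  set y₀ := closeLeaf e₁ y with hy₀
  set w := A3InactiveTyped.flipOn F y with hw
  set w₀ := A3InactiveTyped.flipOn F y₀ with hw₀
  have hagree_y : ∀ e, e ≠ e₁ → y₀ e = y e := fun e he => closeLeaf_of_ne he y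
  have hagree_w : ∀ e, e ≠ e₁ → w₀ e = w e := by
    intro e he
    simp only [hw₀, hw, A3InactiveTyped.flipOn, hagree_y e he]
  -- the events not involving `o` agree between `y` and `y₀`, and between `w` and `w₀`
  have hQy : (iQ ends a₁ a₂ y₀ : R) = iQ ends a₁ a₂ y :=
    iQ_congr (conn_leaf_agree_iff h₁ hleaf hagree_y ho2.symm ho1.symm)
  have hQw : (iQ ends a₁ a₂ w₀ : R) = iQ ends a₁ a₂ w :=
    iQ_congr (conn_leaf_agree_iff h₁ hleaf hagree_w ho2.symm ho1.symm)
  have hAy : (iL ends a₁ b y₀ : R) = iL ends a₁ b y :=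
    iL_congr (conn_leaf_agree_iff h₁ hleaf hagree_y ho1.symm hob.symm)
  -- the `o`-events: open leaf in `y` (so `o ∈ C₂(y)` iff `v ∈ C₂(y)`), closed in `w`, `y₀`; open in `w₀`
  have hBy : (iH ends a₂ o y : R) = iH ends a₂ v y := by
    apply iH_congr'
    rw [conn_leaf_at_iff h₁ hleaf ho2]
    exact ⟨fun h => h.2, fun h => ⟨hy, h⟩⟩
  have hBw : (iH ends a₂ o w : R) = 0 := by
    rw [iH_eq_ite, if_neg]
    intro h
    have := (conn_leaf_at_iff h₁ hleaf ho2 w).1 h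
    simp [hw, A3InactiveTyped.flipOn, hF, hy] at this
  have hBy₀ : (iH ends a₂ o y₀ : R) = 0 := by
    rw [iH_eq_ite, if_neg]
    intro h
    have := (conn_leaf_at_iff h₁ hleaf ho2 y₀).1 h
    simp [hy₀, closeLeaf] at this
  have hBw₀ : (iH ends a₂ o w₀ : R) = iH ends a₂ v w := by
    apply iH_congr'
    rw [conn_leaf_at_iff h₁ hleaf ho2]
    have hopen : w₀ e₁ = true := by simp [hw₀, hy₀, A3InactiveTyped.flipOn, closeLeaf, hF]
    constructor
    · rintro ⟨_, h⟩
      exact (conn_leaf_agree_iff h₁ hleaf hagree_w ho2.symm hov.symm).1 h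
    · intro h
      exact ⟨hopen, (conn_leaf_agree_iff h₁ hleaf hagree_w ho2.symm hov.symm).2 h⟩
  -- the `v`-events at the closed-leaf configuration, in terms of `y` and `w`
  have hVy₀ : (iH ends a₂ v y₀ : R) = iH ends a₂ v y :=
    iH_congr (conn_leaf_agree_iff h₁ hleaf hagree_y ho2.symm hov.symm)
  have hVw₀ : (iH ends a₂ v (A3InactiveTyped.flipOn (F.erase e₁) y₀) : R) = iH ends a₂ v w := by
    rw [flip_erase_closeLeaf]
    apply iH_congr
    exact conn_leaf_agree_iff h₁ hleaf (y := w) (y' := closeLeaf e₁ w)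
      (fun e he => closeLeaf_of_ne he w) ho2.symm hov.symm
  have hQw' : (iQ ends a₁ a₂ (A3InactiveTyped.flipOn (F.erase e₁) y₀) : R) = iQ ends a₁ a₂ w := by
    rw [flip_erase_closeLeaf]
    exact iQ_congr (conn_leaf_agree_iff h₁ hleaf (y := w) (y' := closeLeaf e₁ w)
      (fun e he => closeLeaf_of_ne he w) ho2.symm ho1.symm)
  simp only [foldBO]
  rw [hQy, hQw, hAy, hBy, hBw, hBy₀, hBw₀, hVy₀, hVw₀, hQw']
  ring

/-- Splitting a sum over configurations by the state of `e₁`, pairing `y` with `y` toggled at `e₁`. -/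
lemma sum_split_toggle (e₁ : E) (g : Config E → R) :
    ∑ y : Config E, g y =
      ∑ y : Config E, (if y e₁ = true then g y + g (A3InactiveTyped.flipOn {e₁} y) else 0) := by
  have hτ : Function.Involutive (A3InactiveTyped.flipOn ({e₁} : Finset E)) :=
    fun y => A3InactiveTyped.flipOn_flipOn _ y
  have h1 : ∑ y : Config E, g y =
      ∑ y : Config E, (if y e₁ = true then g y else 0) +
        ∑ y : Config E, (if y e₁ = true then (0 : R) else g y) := by
    rw [← Finset.sum_add_distrib]
    refine Finset.sum_congr rfl fun y _ => ?_
    split_ifs <;> simp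
  have h2 : ∑ y : Config E, (if y e₁ = true then (0 : R) else g y) =
      ∑ y : Config E, (if y e₁ = true then g (A3InactiveTyped.flipOn {e₁} y) else 0) := by
    refine Fintype.sum_equiv hτ.toPerm _ _ (fun y => ?_)
    simp only [Function.Involutive.coe_toPerm]
    have : A3InactiveTyped.flipOn ({e₁} : Finset E) y e₁ = !(y e₁) := by
      simp [A3InactiveTyped.flipOn]
    rw [this, hτ y]
    cases y e₁ <;> simp
  rw [h1, h2, ← Finset.sum_add_distrib]
  refine Finset.sum_congr rfl fun y _ => ?_
  split_ifs <;> simp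

/-- **The pendant rule for the folded (TB14) count**: with `o` a leaf at `v` through the free edge
`e₁`, the folded count for the mark `o` at `(F, z)` is the folded count for the mark `v` at
`(F ∖ {e₁}, z[e₁ ↦ closed])`. -/
theorem pairCount_fold_pendant (ends : E → Sym2 V) (a₁ a₂ b v o : V) (F : Finset E) (z : Config E)
    (e₁ : E) (h₁ : ends e₁ = s(v, o)) (hleaf : ∀ e, o ∈ ends e → e = e₁) (ho2 : o ≠ a₂)
    (ho1 : o ≠ a₁) (hob : o ≠ b) (hov : o ≠ v) (hF : e₁ ∈ F) :
    pairCount F z (foldBO ends a₁ a₂ b o : Config E → Config E → R) =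
      pairCount (F.erase e₁) (closeLeaf e₁ z) (foldBO ends a₁ a₂ b v) := by
  unfold pairCount
  have hL := sum_split_toggle e₁ (fun y : Config E => if (∀ e, e ∉ F → y e = z e) then
    (foldBO ends a₁ a₂ b o y (A3InactiveTyped.flipOn F y) : R) else 0)
  have hR := sum_split_toggle e₁ (fun y : Config E =>
    if (∀ e, e ∉ F.erase e₁ → y e = closeLeaf e₁ z e) then
      (foldBO ends a₁ a₂ b v y (A3InactiveTyped.flipOn (F.erase e₁) y) : R) else 0)
  rw [hL, hR]
  refine Finset.sum_congr rfl fun y _ => ?_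
  by_cases hy : y e₁ = true
  · rw [if_pos hy, if_pos hy]
    have hτy : A3InactiveTyped.flipOn {e₁} y = closeLeaf e₁ y := by
      funext e
      by_cases he : e = e₁
      · subst he; simp [A3InactiveTyped.flipOn, closeLeaf, hy]
      · simp [A3InactiveTyped.flipOn, closeLeaf, he]
    rw [hτy]
    -- admissibility of `closeLeaf e₁ y` at `(F, z)` is admissibility of `y`
    have hadmF : (∀ e, e ∉ F → closeLeaf e₁ y e = z e) ↔ (∀ e, e ∉ F → y e = z e) := by
      constructor
      · intro h e he
        have hne : e ≠ e₁ := fun h' => he (by rw [h']; exact hF)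
        rw [← closeLeaf_of_ne hne y]; exact h e he
      · intro h e he
        have hne : e ≠ e₁ := fun h' => he (by rw [h']; exact hF)
        rw [closeLeaf_of_ne hne y]; exact h e he
    -- admissibility at the smaller profile: `y` itself is never admissible (`e₁` open),
    -- `closeLeaf e₁ y` is admissible iff `y` is admissible at `(F, z)`
    have hadm1 : ¬ (∀ e, e ∉ F.erase e₁ → y e = closeLeaf e₁ z e) := by
      intro h
      have := h e₁ (Finset.notMem_erase e₁ F)
      rw [closeLeaf_self, hy] at this
      exact Bool.true_eq_false.mp this
    have hadm2 : (∀ e, e ∉ F.erase e₁ → closeLeaf e₁ y e = closeLeaf e₁ z e) ↔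
        (∀ e, e ∉ F → y e = z e) := by
      constructor
      · intro h e he
        have he' : e ∉ F.erase e₁ := fun h' => he (Finset.mem_of_mem_erase h')
        have hne : e ≠ e₁ := fun h' => he (by rw [h']; exact hF)
        have := h e he'
        rwa [closeLeaf_of_ne hne, closeLeaf_of_ne hne] at this
      · intro h e he
        by_cases hne : e = e₁
        · subst hne; rw [closeLeaf_self, closeLeaf_self]
        · have : e ∉ F := fun h' => he (Finset.mem_erase.2 ⟨hne, h'⟩)
          rw [closeLeaf_of_ne hne, closeLeaf_of_ne hne]; exact h e this
    rw [if_neg hadm1, zero_add]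
    simp only [hadmF, hadm2]
    split_ifs with hadm
    · exact fold_leaf_pair ends a₁ a₂ b v o F e₁ h₁ hleaf ho2 ho1 hob hov hF y hy
    · simp
  · rw [if_neg hy, if_neg hy]

/-- **The pendant rule for (TB14)**: the (TB14) slack for `(b, o)` at `(F, z)` is the (TB14) slack
for `(b, v)` at `(F ∖ {e₁}, z[e₁ ↦ closed])` — the leaf `o` at `v` reduces to the mark `v`. -/
theorem tb14_slack_pendant (ends : E → Sym2 V) (a₁ a₂ b v o : V) (F : Finset E) (z : Config E)
    (e₁ : E) (h₁ : ends e₁ = s(v, o)) (hleaf : ∀ e, o ∈ ends e → e = e₁) (ho2 : o ≠ a₂)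
    (ho1 : o ≠ a₁) (hob : o ≠ b) (hov : o ≠ v) (hF : e₁ ∈ F) :
    pairCount F z (sameBO ends a₁ a₂ b o : Config E → Config E → R) -
        pairCount F z (crossBO ends a₁ a₂ b o) =
      pairCount (F.erase e₁) (closeLeaf e₁ z) (sameBO ends a₁ a₂ b v) -
        pairCount (F.erase e₁) (closeLeaf e₁ z) (crossBO ends a₁ a₂ b v) := by
  rw [pairCount_fold, pairCount_fold]
  exact pairCount_fold_pendant ends a₁ a₂ b v o F z e₁ h₁ hleaf ho2 ho1 hob hov hF

/-- **The pendant rule, pinned-open leaf edge**: if `e₁ ∉ F` and `z e₁ = true`, the folded counts for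
the marks `o` and `v` agree at `(F, z)`. -/
theorem pairCount_fold_pendant_open (ends : E → Sym2 V) (a₁ a₂ b v o : V) (F : Finset E)
    (z : Config E) (e₁ : E) (h₁ : ends e₁ = s(v, o)) (hleaf : ∀ e, o ∈ ends e → e = e₁)
    (ho2 : o ≠ a₂) (hF : e₁ ∉ F) (hz : z e₁ = true) :
    pairCount F z (foldBO ends a₁ a₂ b o : Config E → Config E → R) =
      pairCount F z (foldBO ends a₁ a₂ b v) := by
  unfold pairCount
  refine Finset.sum_congr rfl fun y _ => ?_
  split_ifs with hy
  · have hy1 : y e₁ = true := by rw [hy e₁ hF]; exact hz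
    have hw1 : A3InactiveTyped.flipOn F y e₁ = true := by
      rw [A3InactiveTyped.flipOn_of_notMem hF]; exact hy1
    have h1 : (iH ends a₂ o y : R) = iH ends a₂ v y := by
      apply iH_congr'
      rw [conn_leaf_at_iff h₁ hleaf ho2]
      exact ⟨fun h => h.2, fun h => ⟨hy1, h⟩⟩
    have h2 : (iH ends a₂ o (A3InactiveTyped.flipOn F y) : R) =
        iH ends a₂ v (A3InactiveTyped.flipOn F y) := by
      apply iH_congr'
      rw [conn_leaf_at_iff h₁ hleaf ho2]
      exact ⟨fun h => h.2, fun h => ⟨hw1, h⟩⟩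
    simp only [foldBO, h1, h2]
  · rfl

/-- **The pendant rule, pinned-closed leaf edge**: if `e₁ ∉ F` and `z e₁ = false`, the folded count
for the mark `o` vanishes. -/
theorem pairCount_fold_pendant_closed (ends : E → Sym2 V) (a₁ a₂ b v o : V) (F : Finset E)
    (z : Config E) (e₁ : E) (h₁ : ends e₁ = s(v, o)) (hleaf : ∀ e, o ∈ ends e → e = e₁)
    (ho2 : o ≠ a₂) (hF : e₁ ∉ F) (hz : z e₁ = false) :
    pairCount F z (foldBO ends a₁ a₂ b o : Config E → Config E → R) = 0 := by
  unfold pairCount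
  refine Finset.sum_eq_zero fun y _ => ?_
  split_ifs with hy
  · have hy0 : y e₁ = false := by rw [hy e₁ hF]; exact hz
    have hw0 : A3InactiveTyped.flipOn F y e₁ = false := by
      rw [A3InactiveTyped.flipOn_of_notMem hF]; exact hy0
    have h1 : (iH ends a₂ o y : R) = 0 := by
      rw [iH_eq_ite, if_neg]
      intro h
      have := ((conn_leaf_at_iff h₁ hleaf ho2 y).1 h).1
      rw [hy0] at this; exact Bool.false_ne_true this
    have h2 : (iH ends a₂ o (A3InactiveTyped.flipOn F y) : R) = 0 := by
      rw [iH_eq_ite, if_neg]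
      intro h
      have := ((conn_leaf_at_iff h₁ hleaf ho2 _).1 h).1
      rw [hw0] at this; exact Bool.false_ne_true this
    simp only [foldBO, h1, h2]; ring
  · rfl

end Pendant

end TB14Fold

end Summit.Ventures.PercRepro2
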